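import Summits.QuantumAdvantage.QuantumAdvantage.Theorems.CubicForrelationSignedExactSliceIsLiftDefs
import Literature.Computability.QuantumComplexity.SignedForrelationMem

/-!
# Stub `stub_V` of line `Sketch` (crux K2 `SignedExactSliceIsLift`, stmt-QuantumAdvantage-14830)

The value set of the LANDED uniform Clifford+T family `PhaseQuery.family SgnForrMem.paramsS` (the signed 2-fold
Forrelation test of [cite: AaronsonAmbainis2018, §3.2 Prop. 6]) on the two sides of the θ-gapped canonical slice
`gappedSlice`, given the crux hypothesis `NearExactIsExact`. On ANY string the family accepts with probability
`1 − (1 − ‖φ_fin‖²)³` (`PhaseQuery.acceptProbOn_family`); on the code of an instance with `k = 2`, `n` even and at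
most one idle input wire (`n ≤ #R + 1`) the return amplitude has modulus EXACTLY `(1 + Φ(I))/2`
(`StubV.norm_phiFin_of_le`: the proof of `SgnForrMem.norm_phiFin_of_promise` with the promise replaced by the
well-formedness clause, where for even `n` the idle factor is `ρ = 1`), so the acceptance probability is
`1 − (1 − ((1 + Φ(I))/2)²)³` (`StubV.acceptProbOn_encode`). Yes-codes have `Φ = 1`, hence acceptance `1`; a no-code is
the code of a well-formed cubic instance with `Φ ≠ 1`, so by `NearExactIsExact` (contrapositively, both circuits being
cubic on an even number of variables, `KForrelationInstance.value_eq_forrelation`) `Φ ≤ θ`, and monotonicity of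
`a ↦ 1 − (1 − a²)³` on `[0, 1]` bounds the acceptance by `p₀ := 1 − (1 − ((1 + max θ 0)/2)²)³ < 1`.
-/

set_option linter.dupNamespace false -- D-0017: single-problem summit ⇒ `QuantumAdvantage.QuantumAdvantage` by design

noncomputable section

namespace Summit.QuantumAdvantage.QuantumAdvantage.Theorems.SignedExactSliceIsLift

open _root_.Computability Literature.Computability.Complexity Literature.Computability.Cryptography
  Literature.Computability.QuantumComplexity
open Literature.Computability.Complexity.CodeFP (strE unE natE bitE pairE rawE)
open Summit.QuantumAdvantage.QuantumAdvantage.Theses.CubicForrelation (NearExactIsExact SignedExactSliceIsLift)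

namespace StubV

open ForrMem SgnForrMem PhaseQuery

variable (I : KForrelationInstance)

/-- **The return amplitude on a well-formed code** (`k = 2`, `n` even, at most one idle wire) has modulus EXACTLY
`(1 + Φ(I))/2`: the gadget amplitude with idle factor `ρ = 1`. [cite: AaronsonAmbainis2018, §3.2 Prop. 6] -/
theorem norm_phiFin_of_le (hk : I.k = 2) (h : I.n ≤ sR I + 1) (he : Even I.n) (A : Language Bool) :
    ‖phiFin paramsS specS I.encode A fun _ => false‖ = (1 + I.value) / 2 := by
  obtain ⟨hq, hq0⟩ := isSelfDualBent_qM (even_WdS_of_le I h)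
  have e : forrelation (fun w : Fin (WdS I) → Bool => cfun I 0 w) (fun w => cfun I 1 w) = I.value := by
    rw [forrelation_cfun I hk (WdS I) (sR_le_WdS I), value_eq, hk, WdS_eq_of_le I h, if_pos he, Nat.add_zero]
  rw [phiFin_encode I hk, gS_vec, Complex.norm_real, Real.norm_eq_abs]
  have hg := kForrelationValue_gadget (fun w : Fin (WdS I) → Bool => cfun I 0 w) (fun w => cfun I 1 w) (qW I) hq hq0
  simp only at hg
  rw [show (qW I) = fun w => qW I w from rfl] at hg
  erw [hg, abs_gadget, e]

/-- **The acceptance probability of the landed signed family on a well-formed code** is EXACTLY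
`1 − (1 − ((1 + Φ(I))/2)²)³`. [cite: AaronsonAmbainis2018, §3.2 Prop. 6 and §6 (p. 26)] -/
theorem acceptProbOn_encode (hk : I.k = 2) (h : I.n ≤ sR I + 1) (he : Even I.n) :
    (family paramsS).acceptProbOn 0 I.encode = 1 - (1 - ((1 + I.value) / 2) ^ 2) ^ 3 := by
  rw [acceptProbOn_family paramsS specS I.encode 0, norm_phiFin_of_le I hk h he]

/-- Monotonicity of the acceptance statistics `a ↦ 1 − (1 − a²)³` on `[0, 1]`. [folklore] -/
theorem accept_mono {a b : ℝ} (ha0 : 0 ≤ a) (hab : a ≤ b) (hb1 : b ≤ 1) :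
    1 - (1 - a ^ 2) ^ 3 ≤ 1 - (1 - b ^ 2) ^ 3 := by
  have h0 : 0 ≤ 1 - b ^ 2 := by nlinarith
  have h1 : 1 - b ^ 2 ≤ 1 - a ^ 2 := by nlinarith
  have h2 : (1 - b ^ 2) ^ 3 ≤ (1 - a ^ 2) ^ 3 := pow_le_pow_left₀ h0 h1 3
  linarith

/-- The threshold `p₀(θ') = 1 − (1 − ((1 + θ')/2)²)³` is `< 1` for `0 ≤ θ' < 1`. [folklore] -/
theorem accept_lt_one {t : ℝ} (ht0 : 0 ≤ t) (ht1 : t < 1) : 1 - (1 - ((1 + t) / 2) ^ 2) ^ 3 < 1 := by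
  have h1 : 0 < 1 - ((1 + t) / 2) ^ 2 := by nlinarith
  have h2 : 0 < (1 - ((1 + t) / 2) ^ 2) ^ 3 := pow_pos h1 3
  linarith

end StubV

/-- **Stub V (value set of the landed signed family on the gapped slice).** Given `NearExactIsExact` there is a
threshold `p₀ < 1` such that the uniform Clifford+T family `PhaseQuery.family SgnForrMem.paramsS` accepts every
yes-code of `gappedSlice` with probability exactly `1` and every no-code with probability `≤ p₀`.
[cite: AaronsonAmbainis2018, §3.2 Prop. 6 and §6 (p. 26)] -/
theorem stub_V : NearExactIsExact → ∃ p₀ : ℝ, p₀ < 1 ∧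
    (∀ x ∈ gappedSlice.yes, (PhaseQuery.family SgnForrMem.paramsS).acceptProbOn 0 x = 1) ∧
    (∀ x ∈ gappedSlice.no, (PhaseQuery.family SgnForrMem.paramsS).acceptProbOn 0 x ≤ p₀) := by
  rintro ⟨θ, hθ, hNE⟩
  have hθ0 : 0 ≤ max θ 0 := le_max_right _ _
  have hθ1 : max θ 0 < 1 := max_lt hθ one_pos
  refine ⟨1 - (1 - ((1 + max θ 0) / 2) ^ 2) ^ 3, StubV.accept_lt_one hθ0 hθ1, ?_, ?_⟩
  · rintro x ⟨I, ⟨_, hv, hk, he, _⟩, rfl⟩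
    have h : I.n ≤ ForrMem.sR I + 1 := SgnForrMem.n_le_of_promise I hk (by rw [hv]; norm_num)
    rw [StubV.acceptProbOn_encode I hk h he, hv]
    norm_num
  · rintro x ⟨I, ⟨⟨_, hk, he, hdeg, h⟩, hv⟩, rfl⟩
    rw [StubV.acceptProbOn_encode I hk h he]
    have hle : I.value ≤ max θ 0 := by
      refine not_lt.1 fun hlt => hv ?_
      rw [KForrelationInstance.value_eq_forrelation hk] at hlt ⊢
      exact hNE I.n he _ _ (hdeg _) (hdeg _) (lt_of_le_of_lt (le_max_left _ _) hlt)
    have hm1 : -1 ≤ I.value := (abs_le.1 (SgnForrMem.abs_value_le_one I)).1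
    exact StubV.accept_mono (by linarith) (by linarith) (by linarith)

end Summit.QuantumAdvantage.QuantumAdvantage.Theorems.SignedExactSliceIsLift

end
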